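import Literature.AlgebraicGeometry.Resolution.BenitoVillamayor2013StrongMonomial
import Literature.AlgebraicGeometry.Resolution.PointBlowupShade
import Literature.AlgebraicGeometry.Resolution.RegularSystemOfParameters
import Literature.AlgebraicGeometry.Resolution.AdicOrderBasics
import Mathlib.RingTheory.IntegralClosure.IntegrallyClosed
import HarnessLib

/-!
# Benito–Villamayor 2013, Thm. 7.11 (ii): «unit times the tight monomial» — COEFFICIENT LEVEL

Topic: `Literature/AlgebraicGeometry/Resolution`; companion of `BenitoVillamayor2013StrongMonomial.lean` (Def. 7.10 as
`BV2013.IsStrongMonomialAt q f ρ t` with the tight monomial ORDER `t` as a parameter, and alternative (i) of Thm. 7.11)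
and sequel of `BenitoVillamayor2013Cleaning.lean` (same conventions: the
local ring `S` stands for `𝒪_{V^{(d−1)},y}`, `ν = adicOrder`, the pure `p`-presentation is `z^q + a`, `q = pᵉ`,
`a = a_{pᵉ} ∈ S`). Source: A. Benito, O. E. Villamayor U., *Monoidal transforms and invariants of singularities in
positive characteristic*, Compositio Math. **149** (2013) 1267–1311 = arXiv:1004.1803v2 [BenitoVillamayoru2013], §7,
held text `paper:arxiv-1004.1803` p.23:

* **Def. 7.10** «`𝒢_r` is said to be within the strong monomial case at a closed point `x ∈ Sing(𝒢_r)` if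
  `v-ord^{(d−1)}(𝒢_r)(x) = ord(𝔪_r W^s)(x)`» (`𝔪_r W^s` the tight monomial algebra, `𝔪_r` a monomial in the
  equations of the exceptional hypersurfaces `H_1, …, H_r` with exponents `h_i`, §7.8–7.9);
* **Thm. 7.11 (Characterization of the strong monomial case)** «Fix a closed point `x ∈ Sing(𝒢_r)`. Let
  `p𝒫(β_r, z, f_{pᵉ})` be well-adapted to `𝒢_r` at `x` and compatible with the tight monomial algebra `𝔪_r W^s`.
  The algebra `𝒢_r` is in the strong monomial case at `x` if and only if one of the following conditions holds in an
  open neighborhood, either (i) `(ℛ_{𝒢,β})_r = 𝔪_r W^s`, or (ii) The `𝒪_{V^{(d−1)}}`-algebra spanned by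
  `a_{pᵉ} W^{pᵉ}`, namely `𝒪_{V^{(d−1)}}[a_{pᵉ}W^{pᵉ}]`, has the same integral closure as `𝒪_{V^{(d−1)}}[𝔪_r W^s]`.»

## What is typed, and how (read before using)

As in the sibling files the elimination algebra `(ℛ_{𝒢,β})_r` cannot be named (no Rees / elimination algebras in the
tree); Def. 7.10 and alternative (i) are rendered in `BenitoVillamayor2013StrongMonomial.lean` through the ORDERS
`ρ`, `t`. Typed HERE is the COEFFICIENT-LEVEL content of alternative **(ii)**, which that file leaves aside and which concerns only the element `a = a_{pᵉ}` of the local ring `S = 𝒪_{V^{(d−1)},x}` and the monomial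
`M = 𝔪_r = ∏ x_i^{h_i}` in the exceptional parameters `x_i`:

* `BV2013.excMonomial x h = ∏ x_i^{h_i}`;
* `BV2013.SameClosureAsMonomial q s x h a :≡ ∃ u ∈ Sˣ, a^s = u·M^q` — RENDERING of (ii): for graded `S`-algebras
  generated in one degree, `S[aW^q]` and `S[MW^s]` have the same integral closure iff their Veronese ideals `(a^s)`
  and `(M^q)` (degree `qs`) have the same integral closure, and principal ideals of a normal domain are integrally
  closed, so for normal `S` (ii) reads `(a^s) = (M^q)`, i.e. `a^s = u·M^q` with `u` a unit — this last form is the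
  definition; the equivalence with the printed wording is the sentence above and is not formalised;
* `BV2013.IsUnitMonomial x a :≡ ∃ h, ∃ u ∈ Sˣ, a = u·x^h` («`a` is a monomial in the exceptional variables times a
  unit») and `BV2013.IsStrongMonomialCoeff q x a` (the same with the monomial NOT a `q`-th power: `∃ i, q ∤ h_i`) —
  the polynomial-level predicate under which alternative (ii) is tested on explicit presentations `z^q + a`.

PROVED: `isUnitMonomial`-form ⟺ `SameClosureAsMonomial q q` in an integrally closed domain
(`exists_eq_units_mul_iff_sameClosureAsMonomial`, Mathlib `IsIntegrallyClosed.pow_dvd_pow_iff`); the order of a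
monomial in parameters of order one in a regular local ring (`adicOrder_excMonomial`); the DEGENERATE direction
`initIsPow_of_forall_dvd`: if every `h_i` is divisible by `q` and `−u(0)` is a `q`-th power of the residue field
(automatic over a perfect residue field of characteristic `p`, `exists_add_pow_mem_maximalIdeal`), then
`In(a)` is a `q`-th power in the sense `BV2013.InitIsPow` of the sibling file — so the pure presentation `z^q + a` is
in case B3), not B2) (`not_isCaseB2_X_pow_add_C_of_forall_dvd`); and the cheap half of the converse,
`not_initIsPow_of_not_dvd_degree` (total degree `|h|` not divisible by `q` ⇒ `¬ InitIsPow`, by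
`BV2013.exists_order_eq_of_lt`); and the BRIDGE to Def. 7.10 as typed next door: the pure head `z^{pᵉ} + u·x^h` with
`pᵉ ∤ |h|` is `IsStrongMonomialAt … ρ (|h|/pᵉ)` — in the strong monomial case exactly when the tight monomial order at
the point is `|h|/pᵉ`, i.e. when `x^h` IS the tight monomial (`isStrongMonomialAt_X_pow_add_C_units_mul_excMonomial`).

And the FULL CONVERSE for a regular system of parameters `x` in characteristic `p`, `q = pᵉ`:
`not_initIsPow_units_mul_excMonomial_rsop` — if some `h_i` is not divisible by `pᵉ` then `In(u·x^h)` is NOT a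
`pᵉ`-th power (via `gr_𝔪(S) ≅ k[X]`, the tree's `coeff_mem_maximalIdeal_of_eval_mem_pow`, Matsumura 17.10, and
Frobenius `coeff_pow_char_pow_eq_zero`), so the strong-monomial shape excludes case B3)
(`IsStrongMonomialCoeff.not_initIsPow_rsop`, `IsStrongMonomialCoeff.not_isCaseB3_X_pow_add_C`), hence is
WELL-ADAPTED for positive slope (`IsStrongMonomialCoeff.isWellAdapted_X_pow_add_C`, Def. 5.5 (1) via Rem. 5.7's round)
and, for `pᵉ ∤ |h|`, in the strong monomial case of Def. 7.10 with `t = |h|/pᵉ`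
(`isWellAdapted_and_isStrongMonomialAt_X_pow_add_C`).

-- TODO(general form): Def. 7.10 / Thm. 7.11 (i) need `(ℛ_{𝒢,β})_r`, `v-ord^{(d−1)}` and the tight monomial
-- algebra as objects (Villamayor 2007/2008 elimination algebras); the converse is stated for a FULL regular system of
-- parameters indexed by `Fin d` (a sub-family version follows by extending the family).

No named facts (`def … : Prop` without body) are introduced. AI-written; AI review is weaker than expert review.
-/

noncomputable section

open IsLocalRing Polynomial

namespace Literature.AlgebraicGeometry.Resolution

namespace BV2013

universe u v

variable {S : Type u} [CommRing S] {Λ : Type v}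

/-! ## Monomials in the exceptional parameters -/

/-- The monomial `x^h = ∏_i x_i^{h_i}` in a family `x : Λ → S` (the equations of the exceptional hypersurfaces
through the point; `𝔪_r = ∏ x_i^{h_i}` is the tight monomial). [cite: BenitoVillamayoru2013, §7.9 and Def. 7.10,
arXiv v2 p.23] -/
def excMonomial (x : Λ → S) (h : Λ →₀ ℕ) : S :=
  h.prod fun i n => x i ^ n

/-- `x^0 = 1`. [cite: BenitoVillamayoru2013, §7.9, arXiv v2 p.23] -/
@[simp] theorem excMonomial_zero (x : Λ → S) : excMonomial x 0 = 1 :=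
  Finsupp.prod_zero_index

/-- `x^{h+h'} = x^h · x^{h'}`. [cite: BenitoVillamayoru2013, §7.9, arXiv v2 p.23] -/
theorem excMonomial_add (x : Λ → S) (h h' : Λ →₀ ℕ) :
    excMonomial x (h + h') = excMonomial x h * excMonomial x h' :=
  Finsupp.prod_add_index' (fun i => pow_zero (x i)) (fun i m n => pow_add (x i) m n)

/-- `x^{single i n} = x_i^n`. [cite: BenitoVillamayoru2013, §7.9, arXiv v2 p.23] -/
@[simp] theorem excMonomial_single (x : Λ → S) (i : Λ) (n : ℕ) :
    excMonomial x (Finsupp.single i n) = x i ^ n :=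
  Finsupp.prod_single_index (pow_zero (x i))

/-- `x^{n•h} = (x^h)^n`. [cite: BenitoVillamayoru2013, §7.9, arXiv v2 p.23] -/
theorem excMonomial_nsmul (x : Λ → S) (n : ℕ) (h : Λ →₀ ℕ) :
    excMonomial x (n • h) = excMonomial x h ^ n := by
  induction n with
  | zero => rw [zero_smul, excMonomial_zero, pow_zero]
  | succ n ih => rw [succ_nsmul, excMonomial_add, ih, pow_succ]

/-! ## The predicates -/

/-- «`a` is a monomial in the exceptional variables times a unit»: `a = u · x^h`, `u ∈ Sˣ` (`u(0) ≠ 0`).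
[cite: BenitoVillamayoru2013, Thm. 7.11 (ii), arXiv v2 p.23] -/
def IsUnitMonomial (x : Λ → S) (a : S) : Prop :=
  ∃ (h : Λ →₀ ℕ) (u : Sˣ), a = u * excMonomial x h

/-- Thm. 7.11 **(ii)**, COEFFICIENT-LEVEL RENDERING (module docstring): «`𝒪[a W^{q}]` has the same integral closure
as `𝒪[𝔪_r W^s]`», for a normal local ring read as `(a^s) = (𝔪_r^q)`, i.e. `a^s = u · (x^h)^q` with `u` a unit
(`q = pᵉ` the degree of the presentation, `s` the degree and `h` the exponents of the tight monomial algebra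
`𝔪_r W^s`). [cite: BenitoVillamayoru2013, Thm. 7.11 (ii), arXiv v2 p.23] -/
def SameClosureAsMonomial (q s : ℕ) (x : Λ → S) (h : Λ →₀ ℕ) (a : S) : Prop :=
  ∃ u : Sˣ, a ^ s = u * excMonomial x h ^ q

/-- The **strong monomial case at the point, polynomial level** (the test applied to explicit pure presentations
`z^q + a`): `a = u · x^h` with `u` a unit and the monomial `x^h` NOT a `q`-th power (`∃ i, q ∤ h_i`; were it one, the
presentation would not be well-adapted — `initIsPow_of_forall_dvd`). Alternative (i) of Thm. 7.11 is not covered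
(module docstring). [cite: BenitoVillamayoru2013, Def. 7.10 and Thm. 7.11 (ii), arXiv v2 p.23] -/
def IsStrongMonomialCoeff (q : ℕ) (x : Λ → S) (a : S) : Prop :=
  ∃ (h : Λ →₀ ℕ) (u : Sˣ), a = u * excMonomial x h ∧ ∃ i, ¬ q ∣ h i

/-- The strong-monomial predicate forgets to «unit times monomial».
[cite: BenitoVillamayoru2013, Thm. 7.11 (ii), arXiv v2 p.23] -/
theorem IsStrongMonomialCoeff.isUnitMonomial {q : ℕ} {x : Λ → S} {a : S} (ha : IsStrongMonomialCoeff q x a) :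
    IsUnitMonomial x a := by
  obtain ⟨h, u, hu, -⟩ := ha
  exact ⟨h, u, hu⟩

/-! ## (ii) with `s = q`: «same integral closure as `𝒪[x^h W^q]`» is «unit times `x^h`» in a normal domain -/

/-- `a = u·x^h` gives `a^q = u^q·(x^h)^q`. [cite: BenitoVillamayoru2013, Thm. 7.11 (ii), arXiv v2 p.23] -/
theorem sameClosureAsMonomial_self_of_eq {q : ℕ} {x : Λ → S} {h : Λ →₀ ℕ} {a : S} (u : Sˣ)
    (ha : a = u * excMonomial x h) : SameClosureAsMonomial q q x h a :=
  ⟨u ^ q, by rw [ha, mul_pow, Units.val_pow_eq_pow_val]⟩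

/-- **In an integrally closed domain, `a^q = u·M^q` with `u` a unit (`q ≠ 0`, `M ≠ 0`) iff `a = u′·M` with `u′` a
unit**: `M^q ∣ a^q` and `a^q ∣ M^q` give `M ∣ a ∣ M` (Mathlib `IsIntegrallyClosed.pow_dvd_pow_iff`). This is why, for
the normal local rings `𝒪_{V^{(d−1)},x}`, alternative (ii) of Thm. 7.11 with `s = pᵉ` says exactly that `a_{pᵉ}` is a
unit times the tight monomial. [cite: BenitoVillamayoru2013, Thm. 7.11 (ii), arXiv v2 p.23] -/
theorem exists_eq_units_mul_iff_sameClosureAsMonomial [IsDomain S] [IsIntegrallyClosed S] {q : ℕ} (hq : q ≠ 0)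
    {x : Λ → S} {h : Λ →₀ ℕ} (hM : excMonomial x h ≠ 0) (a : S) :
    (∃ u : Sˣ, a = u * excMonomial x h) ↔ SameClosureAsMonomial q q x h a := by
  constructor
  · rintro ⟨u, ha⟩
    exact sameClosureAsMonomial_self_of_eq u ha
  · rintro ⟨u, hu⟩
    have h1 : excMonomial x h ^ q ∣ a ^ q := ⟨u, by rw [hu, mul_comm]⟩
    have h2 : a ^ q ∣ excMonomial x h ^ q :=
      ⟨↑u⁻¹, by rw [hu, mul_assoc, mul_comm (excMonomial x h ^ q), ← mul_assoc, Units.mul_inv, one_mul]⟩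
    rw [IsIntegrallyClosed.pow_dvd_pow_iff hq] at h1 h2
    obtain ⟨c, hc⟩ := h1
    obtain ⟨d, hd⟩ := h2
    have hcd : c * d = 1 := by
      have : excMonomial x h * (c * d) = excMonomial x h * 1 := by
        rw [← mul_assoc, ← hc, ← hd, mul_one]
      exact mul_left_cancel₀ hM this
    exact ⟨⟨c, d, hcd, by rwa [mul_comm] at hcd⟩, by rw [hc, mul_comm]⟩

/-! ## Orders: monomials in parameters of order one -/

section Orders

variable [IsRegularLocalRing S]

/-- In a regular local ring, a monomial `x^h` in elements of order one (e.g. members of a regular system of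
parameters) has order `|h| = Σ h_i` (`ν` is a valuation: `adicOrder_mul`). [cite: BenitoVillamayoru2013, §7.9 and
proof of Thm. 7.11 (i) («Σ α_i = ord(…) = Σ h_i»), arXiv v2 p.23] -/
theorem adicOrder_excMonomial {x : Λ → S} (hx : ∀ i, adicOrder (x i) = 1) (h : Λ →₀ ℕ) :
    adicOrder (excMonomial x h) = (h.degree : ℕ∞) := by
  induction h using Finsupp.induction with
  | zero => rw [excMonomial_zero, adicOrder_of_isUnit isUnit_one, map_zero, Nat.cast_zero]
  | single_add i n g _ _ ih =>
    rw [excMonomial_add, adicOrder_mul, excMonomial_single, adicOrder_pow, hx, ih, map_add,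
      Finsupp.degree_single, mul_one, Nat.cast_add]

/-- Multiplying by a unit does not change the order. [cite: BenitoVillamayoru2013, §7.9, arXiv v2 p.23] -/
theorem adicOrder_units_mul (u : Sˣ) (b : S) : adicOrder ((u : S) * b) = adicOrder b := by
  rw [adicOrder_mul, adicOrder_of_isUnit u.isUnit, zero_add]

/-- `ν(u · x^h) = |h|` for a unit `u` and parameters of order one.
[cite: BenitoVillamayoru2013, proof of Thm. 7.11 (i), arXiv v2 p.23] -/
theorem adicOrder_units_mul_excMonomial {x : Λ → S} (hx : ∀ i, adicOrder (x i) = 1) (u : Sˣ) (h : Λ →₀ ℕ) :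
    adicOrder ((u : S) * excMonomial x h) = (h.degree : ℕ∞) := by
  rw [adicOrder_units_mul, adicOrder_excMonomial hx]

/-! ## The degenerate direction: a `q`-th power monomial is case B3), not B2) -/

omit [IsRegularLocalRing S] in
/-- If the residue field is closed under `q`-th roots (e.g. perfect of characteristic `p`, `q = pᵉ`), every `u ∈ S`
admits `v` with `u + v^q ∈ 𝔪` (lift a `q`-th root of `−ū`). [cite: BenitoVillamayoru2013, §5.1 B3) and Prop. 5.3
(«it suffices to choose α so that ν_y(α^{pᵉ} + a_{pᵉ}) > ν_y(a_{pᵉ})»), arXiv v2 p.16 l.55, p.18 l.7–8] -/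
theorem exists_add_pow_mem_maximalIdeal [IsLocalRing S] {q : ℕ}
    (hperf : ∀ r : ResidueField S, ∃ s : ResidueField S, s ^ q = r) (u : S) :
    ∃ v : S, u + v ^ q ∈ maximalIdeal S := by
  obtain ⟨s, hs⟩ := hperf (residue S (-u))
  obtain ⟨v, rfl⟩ := residue_surjective s
  refine ⟨v, ?_⟩
  rw [← residue_eq_zero_iff, map_add, map_pow, hs, map_neg, add_neg_cancel]

/-- **All exponents divisible by `q` ⇒ `In(a)` is a `q`-th power** (case B3) of §5.1, in the rendering
`BV2013.InitIsPow` of the sibling file): if `a = u·x^h` with `q ∣ h_i` for all `i`, the `x_i` of order one, and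
`u + v^q ∈ 𝔪` for some `v` (`−ū` a `q`-th power; automatic over a perfect residue field,
`exists_add_pow_mem_maximalIdeal`), then `α := v·x^{h/q}` raises the order: `ν(α^q + a) = ν((u + v^q)x^h) ≥ |h| + 1
> |h| = ν(a)`. So such a presentation `z^q + a` is NOT well-adapted (cleaning `z ↦ z + α` raises the slope,
Prop. 5.3) — the monomial of the strong monomial case is never a `q`-th power.
[cite: BenitoVillamayoru2013, §5.1 B3), Prop. 5.3 and Thm. 7.11 (ii), arXiv v2 p.16–18, p.23] -/
theorem initIsPow_of_forall_dvd {x : Λ → S} (hx : ∀ i, adicOrder (x i) = 1) {q : ℕ} {h : Λ →₀ ℕ}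
    (hdiv : ∀ i, q ∣ h i) (u : Sˣ) {v : S} (hv : (u : S) + v ^ q ∈ maximalIdeal S) :
    InitIsPow q ((u : S) * excMonomial x h) := by
  classical
  -- `h = q • h'`
  set h' : Λ →₀ ℕ := h.mapRange (· / q) (Nat.zero_div q) with hh'
  have hqh : q • h' = h := by
    ext i
    simp only [hh', Finsupp.smul_apply, Finsupp.mapRange_apply, smul_eq_mul]
    exact Nat.mul_div_cancel' (hdiv i)
  refine ⟨v * excMonomial x h', ?_⟩
  have hM : excMonomial x h = excMonomial x h' ^ q := by rw [← hqh, excMonomial_nsmul]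
  have key : (v * excMonomial x h') ^ q + (u : S) * excMonomial x h =
      ((u : S) + v ^ q) * excMonomial x h := by
    rw [hM]; ring
  rw [adicOrder_units_mul_excMonomial hx, key, adicOrder_mul, adicOrder_excMonomial hx]
  have h1 : (1 : ℕ∞) ≤ adicOrder ((u : S) + v ^ q) := by
    rw [← Nat.cast_one, le_adicOrder_iff, pow_one]
    exact hv
  calc (h.degree : ℕ∞) < 1 + (h.degree : ℕ∞) := by
        rw [← Nat.cast_one, ← Nat.cast_add, Nat.cast_lt]; omega
    _ ≤ adicOrder ((u : S) + v ^ q) + (h.degree : ℕ∞) := by gcongr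

omit [IsRegularLocalRing S] in
/-- For the pure presentation `f = z^q + a` (`q ≠ 0`) the coefficient `a_q` is `a`.
[cite: BenitoVillamayoru2013, Def. 2.14 (ii) and §5.1, arXiv v2 p.11, p.16] -/
theorem coeffA_X_pow_add_C_self {q : ℕ} (hq : q ≠ 0) (a : S) : coeffA q (X ^ q + C a) q = a := by
  rw [coeffA_self, coeff_add, coeff_X_pow, if_neg (Ne.symm hq), coeff_C_zero, zero_add]

/-- Hence, under the hypotheses of `initIsPow_of_forall_dvd`, **the pure presentation `z^q + u·x^h` is not in case
B2)** of §5.1 (whatever `ρ`): the strong monomial case requires a monomial that is not a `q`-th power.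
[cite: BenitoVillamayoru2013, §5.1 B2)/B3) and Thm. 7.11 (ii), arXiv v2 p.16, p.23] -/
theorem not_isCaseB2_X_pow_add_C_of_forall_dvd {x : Λ → S} (hx : ∀ i, adicOrder (x i) = 1) {q : ℕ}
    (hq : q ≠ 0) {h : Λ →₀ ℕ} (hdiv : ∀ i, q ∣ h i) (u : Sˣ) {v : S}
    (hv : (u : S) + v ^ q ∈ maximalIdeal S) (ρ : ℚ) :
    ¬ IsCaseB2 q (X ^ q + C ((u : S) * excMonomial x h)) ρ := by
  rintro ⟨-, -, hnot⟩
  rw [coeffA_X_pow_add_C_self hq] at hnot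
  exact hnot (initIsPow_of_forall_dvd hx hdiv u hv)

/-! ## The cheap half of the converse: total degree not divisible by `q` -/

/-- If `|h|` is NOT divisible by `q` (`q ≠ 0`) then `In(u·x^h)` is not a `q`-th power: no `α` raises the order of
`α^q + u·x^h` beyond `|h|` (`BV2013.exists_order_eq_of_lt`: a raise forces `ν(a) = ℓ·q`). The general converse
(`∃ i, q ∤ h_i` suffices when the `x_i` are part of a regular system of parameters) is TODO(general form) (b) of the
module docstring. [cite: BenitoVillamayoru2013, Rem. 5.7 and Thm. 7.11 (ii), arXiv v2 p.18 l.30–35, p.23] -/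
theorem not_initIsPow_of_not_dvd_degree {x : Λ → S} (hx : ∀ i, adicOrder (x i) = 1) {q : ℕ} (hq : q ≠ 0)
    {h : Λ →₀ ℕ} (hdeg : ¬ q ∣ h.degree) (u : Sˣ) :
    ¬ InitIsPow q ((u : S) * excMonomial x h) := by
  rintro ⟨α, hα⟩
  obtain ⟨ℓ, hℓ, -⟩ := exists_order_eq_of_lt (Nat.pos_of_ne_zero hq)
    (adicOrder_units_mul_excMonomial hx u h) hα
  exact hdeg ⟨ℓ, by rw [hℓ, mul_comm]⟩

omit [IsRegularLocalRing S] in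
/-- So `z^q + u·x^h` with `q ∤ |h|` is in the strong-monomial shape `IsStrongMonomialCoeff` (some `h_i` is not
divisible by `q`, since `|h| = Σ h_i`). [cite: BenitoVillamayoru2013, Thm. 7.11 (ii), arXiv v2 p.23] -/
theorem isStrongMonomialCoeff_of_not_dvd_degree {x : Λ → S} {q : ℕ} {h : Λ →₀ ℕ} (hdeg : ¬ q ∣ h.degree)
    (u : Sˣ) : IsStrongMonomialCoeff q x ((u : S) * excMonomial x h) := by
  classical
  refine ⟨h, u, rfl, ?_⟩
  by_contra hall
  push Not at hall
  apply hdeg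
  rw [Finsupp.degree]
  exact Finset.dvd_sum fun i _ => hall i

/-- **Bridge to Def. 7.10 (`BV2013.IsStrongMonomialAt`)**: over a regular local ring of characteristic `p`, the pure
head `z^{pᵉ} + u·x^h` (`u` a unit, `x_i` of order one, `pᵉ ∤ |h|`, `|h|/pᵉ < ρ`) is within the strong monomial case at
the point for the tight-monomial order `t = |h|/pᵉ` — the value `t` takes when `x^h` is the tight monomial `𝔪_r`
(alternative (ii) with `u` a unit). [cite: BenitoVillamayoru2013, Def. 7.10 and Thm. 7.11 (ii), arXiv v2 p.23] -/
theorem isStrongMonomialAt_X_pow_add_C_units_mul_excMonomial {p : ℕ} (hp : p.Prime) [CharP S p] (e : ℕ)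
    {x : Λ → S} (hx : ∀ i, adicOrder (x i) = 1) (u : Sˣ) {h : Λ →₀ ℕ} (hndvd : ¬ p ^ e ∣ h.degree) {ρ : ℚ}
    (hρ : (h.degree : ℚ) / (p ^ e : ℕ) < ρ) :
    IsStrongMonomialAt (p ^ e) (X ^ (p ^ e) + C ((u : S) * excMonomial x h) : S[X]) ρ
      ((h.degree : ℚ) / (p ^ e : ℕ)) :=
  isStrongMonomialAt_X_pow_add_C hp e (adicOrder_units_mul_excMonomial hx u h) hndvd hρ

end Orders

/-! ## The full converse for a regular system of parameters: Thm. 7.11 (ii) ⇒ case B2) -/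

section RSOP

variable [IsRegularLocalRing S] {d : ℕ} (hd : (maximalIdeal S).spanFinrank = d) (x : Fin d → S)
  (hx : Ideal.span (Set.range x) = maximalIdeal S)

include hd hx in
/-- Members of a regular system of parameters have order one (`gr_𝔪(S) ≅ k[X]`, Matsumura 17.10 as
`coeff_mem_maximalIdeal_of_eval_mem_pow`: were `x_i ∈ 𝔪²`, the degree-one form `X_i` would have its coefficient `1`
in `𝔪`). [cite: BenitoVillamayoru2013, §7.9 (the exceptional hypersurfaces are regular parameters), arXiv v2 p.23] -/
theorem adicOrder_rsop_eq_one (i : Fin d) : adicOrder (x i) = 1 := by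
  classical
  rw [adicOrder_eq_one_iff]
  refine ⟨mem_maximalIdeal_of_rsop x hx i, fun h2 => ?_⟩
  have hF : (MvPolynomial.X i : MvPolynomial (Fin d) S).IsHomogeneous 1 := MvPolynomial.isHomogeneous_X S i
  have hev : MvPolynomial.eval x (MvPolynomial.X i : MvPolynomial (Fin d) S) ∈ maximalIdeal S ^ (1 + 1) := by
    rwa [MvPolynomial.eval_X]
  have h1 := coeff_mem_maximalIdeal_of_eval_mem_pow hd x hx hF hev (Finsupp.single i 1)
  rw [MvPolynomial.coeff_X, if_pos rfl] at h1
  exact (maximalIdeal.isMaximal S).ne_top ((Ideal.eq_top_iff_one _).mpr h1)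

include hd hx in
/-- **Thm. 7.11 (ii) ⇒ case B2): a unit times a monomial in a regular system of parameters which is NOT a `pᵉ`-th
power has initial form NOT a `pᵉ`-th power.** In a regular local ring of characteristic `p` with regular system of
parameters `x`, if some `h_i` is not divisible by `q = pᵉ`, then no `α` raises the order of `α^q + u·x^h` beyond
`|h|`: a raise forces `|h| = ℓq`, `ν(α) = ℓ` (`exists_order_eq_of_lt`), `α = G(x)` for a form `G` of degree `ℓ`;
the form `G^q + u·X^h` of degree `|h|` evaluates into `𝔪^{|h|+1}`, so all its coefficients lie in `𝔪`
(Matsumura 17.10); but `G^q = Σ c^q X^{q·m}` (Frobenius, `coeff_pow_char_pow_eq_zero`) has no `X^h`-term, so the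
`X^h`-coefficient is the unit `u` — contradiction. Hence a pure presentation `z^{pᵉ} + u·x^h` in the
strong-monomial shape is never in case B3): cleaning cannot raise its slope (Prop. 5.3).
[cite: BenitoVillamayoru2013, Thm. 7.11 (ii) with §5.1 B2)/B3) and Prop. 5.3, arXiv v2 p.16–18, p.23] -/
theorem not_initIsPow_units_mul_excMonomial_rsop {p : ℕ} (hp : p.Prime) [CharP S p] (e : ℕ)
    {h : Fin d →₀ ℕ} (hnd : ∃ i, ¬ p ^ e ∣ h i) (u : Sˣ) :
    ¬ InitIsPow (p ^ e) ((u : S) * excMonomial x h) := by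
  classical
  haveI : Fact p.Prime := ⟨hp⟩
  have hx1 : ∀ i, adicOrder (x i) = 1 := adicOrder_rsop_eq_one hd x hx
  rintro ⟨α, hα⟩
  have ha : adicOrder ((u : S) * excMonomial x h) = (h.degree : ℕ∞) :=
    adicOrder_units_mul_excMonomial hx1 u h
  obtain ⟨ℓ, hℓ, hαord⟩ := exists_order_eq_of_lt (pow_pos hp.pos e) ha hα
  -- `α = G(x)`, `G` a form of degree `ℓ`
  have hαmem : α ∈ Ideal.span (Set.range x) ^ ℓ := by
    rw [hx, ← le_adicOrder_iff, hαord]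
  obtain ⟨G, hG, hGα⟩ := exists_isHomogeneous_of_mem_span_pow x ℓ hαmem
  -- the form `G^q + u X^h` of degree `|h|`
  have hFhom : (G ^ p ^ e + MvPolynomial.monomial h (u : S)).IsHomogeneous h.degree := by
    rw [hℓ]
    exact (hG.pow (p ^ e)).add (MvPolynomial.isHomogeneous_monomial _ hℓ)
  have hFeval : MvPolynomial.eval x (G ^ p ^ e + MvPolynomial.monomial h (u : S)) ∈
      maximalIdeal S ^ (h.degree + 1) := by
    have hev : MvPolynomial.eval x (G ^ p ^ e + MvPolynomial.monomial h (u : S)) =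
        α ^ p ^ e + (u : S) * excMonomial x h := by
      rw [map_add, map_pow, hGα, MvPolynomial.eval_monomial]
      rfl
    rw [hev, ← le_adicOrder_iff, Nat.cast_add, Nat.cast_one]
    rw [ha] at hα
    exact Order.add_one_le_of_lt hα
  have hcoeff := coeff_mem_maximalIdeal_of_eval_mem_pow hd x hx hFhom hFeval h
  obtain ⟨i, hi⟩ := hnd
  rw [MvPolynomial.coeff_add, coeff_pow_char_pow_eq_zero p e G h i hi, zero_add,
    MvPolynomial.coeff_monomial, if_pos rfl] at hcoeff
  exact (maximalIdeal.isMaximal S).ne_top (Ideal.eq_top_of_isUnit_mem _ hcoeff u.isUnit)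

include hd hx in
/-- So **the strong-monomial shape in a regular system of parameters excludes case B3)**: for
`IsStrongMonomialCoeff (pᵉ) x a`, `In(a)` is not a `pᵉ`-th power (`¬ InitIsPow`).
[cite: BenitoVillamayoru2013, Thm. 7.11 (ii) and §5.1 B2), arXiv v2 p.16, p.23] -/
theorem IsStrongMonomialCoeff.not_initIsPow_rsop {p : ℕ} (hp : p.Prime) [CharP S p] (e : ℕ) {a : S}
    (ha : IsStrongMonomialCoeff (p ^ e) x a) : ¬ InitIsPow (p ^ e) a := by
  obtain ⟨h, u, rfl, hnd⟩ := ha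
  exact not_initIsPow_units_mul_excMonomial_rsop hd x hx hp e hnd u

include hd hx in
/-- And the pure presentation `z^{pᵉ} + a` with `a` in the strong-monomial shape is **not in case B3)** of §5.1
(whatever `ρ`). [cite: BenitoVillamayoru2013, §5.1 B3) and Thm. 7.11 (ii), arXiv v2 p.16, p.23] -/
theorem IsStrongMonomialCoeff.not_isCaseB3_X_pow_add_C {p : ℕ} (hp : p.Prime) [CharP S p] (e : ℕ) {a : S}
    (ha : IsStrongMonomialCoeff (p ^ e) x a) (ρ : ℚ) : ¬ IsCaseB3 (p ^ e) (X ^ (p ^ e) + C a : S[X]) ρ := by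
  rintro ⟨-, -, h3⟩
  rw [coeffA_X_pow_add_C_self (pow_ne_zero e hp.ne_zero)] at h3
  exact ha.not_initIsPow_rsop hd x hx hp e h3

include hd hx in
/-- **The strong-monomial shape is well-adapted** (what Thm. 7.11 presupposes: «Let p𝒫(β_r, z, f_{pᵉ}) be
well-adapted …»; here DERIVED for pure heads): over a regular local ring of characteristic `p` with regular system of
parameters `x`, the pure presentation `z^{pᵉ} + a` with `a = u·x^h`, `u` a unit, some `h_i` not divisible by `pᵉ`,
and positive slope, is well-adapted in the sense of Def. 5.5 (1) — it is in case A), B1) or B2), never B3)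
(`IsStrongMonomialCoeff.not_isCaseB3_X_pow_add_C` with Rem. 5.7's round `isWellAdapted_or_isCaseB3_of_slopeDichotomy`;
Thm. 4.6's dichotomy is vacuous for pure heads, `slopeDichotomy_X_pow_add_C`).
[cite: BenitoVillamayoru2013, Def. 5.5 (1), Rem. 5.7 and Thm. 7.11, arXiv v2 p.18, p.23] -/
theorem IsStrongMonomialCoeff.isWellAdapted_X_pow_add_C {p : ℕ} (hp : p.Prime) [CharP S p] (e : ℕ) {a : S}
    (ha : IsStrongMonomialCoeff (p ^ e) x a) {ρ : ℚ} (hpos : 0 < slope (p ^ e) (X ^ (p ^ e) + C a : S[X]) ρ) :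
    IsWellAdapted (p ^ e) (X ^ (p ^ e) + C a : S[X]) ρ :=
  (isWellAdapted_or_isCaseB3_of_slopeDichotomy (pow_pos hp.pos e) (slopeDichotomy_X_pow_add_C _ _ _)
    hpos).resolve_right (ha.not_isCaseB3_X_pow_add_C hd x hx hp e ρ)

include hd hx in
/-- Hence, for `pᵉ ∤ |h|` and `0 < |h|/pᵉ < ρ`, the pure head `z^{pᵉ} + u·x^h` is BOTH well-adapted AND within the
strong monomial case of Def. 7.10 for the tight-monomial order `t = |h|/pᵉ` (`BV2013.IsStrongMonomialAt`, the
companion file's rendering) — the full coefficient-level content of Thm. 7.11 (ii) for pure heads.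
[cite: BenitoVillamayoru2013, Def. 5.5 (1), Def. 7.10 and Thm. 7.11 (ii), arXiv v2 p.18, p.23] -/
theorem isWellAdapted_and_isStrongMonomialAt_X_pow_add_C {p : ℕ} (hp : p.Prime) [CharP S p] (e : ℕ) (u : Sˣ)
    {h : Fin d →₀ ℕ} (hndvd : ¬ p ^ e ∣ h.degree) {ρ : ℚ} (hρ : (h.degree : ℚ) / (p ^ e : ℕ) < ρ)
    (hpos : 0 < slope (p ^ e) (X ^ (p ^ e) + C ((u : S) * excMonomial x h) : S[X]) ρ) :
    IsWellAdapted (p ^ e) (X ^ (p ^ e) + C ((u : S) * excMonomial x h) : S[X]) ρ ∧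
      IsStrongMonomialAt (p ^ e) (X ^ (p ^ e) + C ((u : S) * excMonomial x h) : S[X]) ρ
        ((h.degree : ℚ) / (p ^ e : ℕ)) :=
  ⟨(isStrongMonomialCoeff_of_not_dvd_degree hndvd u).isWellAdapted_X_pow_add_C hd x hx hp e hpos,
    isStrongMonomialAt_X_pow_add_C_units_mul_excMonomial hp e (adicOrder_rsop_eq_one hd x hx) u hndvd hρ⟩

end RSOP

end BV2013

end Literature.AlgebraicGeometry.Resolution

end
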